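import Summits.CriticalPhenomena.PercolationContinuityZ3.Theorems.PercNearOneGluingNoHeavyQuantThreeRootGateCoupling
import Summits.CriticalPhenomena.PercolationContinuityZ3.Theorems.PercNearOneGluingNoHeavyQuantGateMoveBlobCells
import HarnessLib

/-!
# QUANT lane R8, T-DEC: THE ATOMIC RE-GATING IDENTITY — the count law of a gated sibling group of three trees is an EXPLICIT mixture of
# gated BLOB sibling groups of the same mean; hence the gate step is DEC at every layer for every outer gate `a ≤ Σqᵢrᵢ/ΣqᵢRᵢ`
# (certified by the kernel slice theorems — no induction hypothesis on composite forests)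

builds on p205010 (kernel theorem, internal audit signed; external expert review pending)

Support file (`--supports stmt-CriticalPhenomena-4575`), QUANT lane seat prim-quant-arm-1 (gen 46, architect); memo
`run/shared/lean/prim/quant/prim-quant-arm-1-g46/ARCH-LIGHT-G46.md` §10.  Theorems only (a local notation `δ[m]` for the point mass),
standard axioms, no sorries; this file = the algebra, the DEC step is the sequel `…QuantThreeRootAtomicStep`.  Complements the generic three-root identity (`…QuantThreeRootGenericCoupling`, large outer gates, no opened boxes)
from the other side: small-to-moderate outer gates, all internal gates opened.

THE IDENTITY (`threeRoot_atomic_regate`).  Boxes `tᵢ = gate_{qᵢ}ρᵢ` (i = 1,2,3; `ρᵢ` any probability law on `{0..Mᵢ}`, `ρ₁ 0 = 0`), outer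
gate `a`, `S = a(q₁R₁+q₂R₂+q₃R₃)` (`Rᵢ` the means).  Writing each `ρᵢ` on its atoms (`gate_atomic`) and using multilinearity
(`lconv_finsetSum_left/right`, `lconv3_atomic`) and the affinity of the gate (`gate_sum_affine`),
  `gate_a(t₁ ∗ t₂ ∗ t₃) = Σ_m w_m · gate_{g_m}(gate_{q₁}δ_{m₁} ∗ gate_{q₂}δ_{m₂} ∗ gate_{q₃}δ_{m₃})`,
  `g_m = S/(q₁m₁+q₂m₂+q₃m₃)`,   `w_m = a·ρ₁m₁ρ₂m₂ρ₃m₃·(q₁m₁+q₂m₂+q₃m₃)/S`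
(`regate_mixture`: the phantom-δ₀ bookkeeping; `Σ w = 1` by `atomic_weights_mean`).  Every component is a BLOB sibling group under a
virtual root with mean exactly `S`.  For a 2-chain box `R[p](R[s])` this is the 'version' split `ρ = (1−s)δ₁ + sδ₂` (bare relay / domino).

THE STEP (sequel file `…QuantThreeRootAtomicStep`, `decAt_threeRoot_atomic`).  If every charged atom triple has `q₁m₁+q₂m₂+q₃m₃ ≥ S` — i.e. `a ≤ Σqᵢrᵢ/ΣqᵢRᵢ` with `rᵢ` the least
atoms (for 2-chain siblings `Σpᵢ/Σpᵢ(1+sᵢ) ≥ 1/2` always) — and the floor `z` satisfies `z·(q₁M₁+q₂M₂+q₃M₃) ≤ S·x` for the blob floor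
`x ≤ qᵢ` (`ρᵢ 0 = 0`, `qᵢ ≤ 1`), then `gate_a(t₁ ∗ t₂ ∗ t₃)` is DEC(j) at floor `z` at EVERY layer `j`: each component is DEC at the common
target by `decAtT_gate_blob3` (three `sdec_slice_blob_of_mixLaw'` + the root gate + Theorem A above the top), and `decAtT_mixture_finset`
closes.  `GatedSliceMixLaw'` is a hypothesis fed by ✓ `gatedSliceMixLaw'_holds` (its module is not imported here).  GUIDANCE (memo §10,
exact): the identity certifies ≈ 97 % of generic k-chain sibling groups with `a < .6` for k = 3, 4, 5 alike, ≈ 30 % of `a ∈ [.6,.8)`, none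
above (g > 1); in particular the lane's hardest tied near-block groups `o[1/2](R[p](R[19/20]))³` (README V398′/V400) and the pattern-infeasible
open-core group `o[7/10](R[9/10](R[4/5]) R[9/10](R[1/5])²)` (RPM3-G70 §3).  The bare 3-star (no internal gate to open) is where it cannot help.

HONEST STATUS.  `GateStepN`, `GateStepNCore`, `FarTreeRow` remain OPEN; RATE class (log\*) and the honest sentence of
`run/shared/lean/prim/quant/README.md` unchanged.  [this work]; slice theorems: this lane (typer/lead gens 28–36); `lconv3_gate_expand`:
census-2 g71.  Nothing here is a published result.  The gluing rows served [cite: KozmaNitzan2024, Conjecture 3 (p. 15)]; product measure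
[cite: Grimmett1999, §1.3 p. 10].
-/

noncomputable section

namespace Summit.CriticalPhenomena.PercolationContinuityZ3.Theorems

namespace Quant

open Finset

namespace LawDec

/-- the point mass at `m` (notation only). -/
local notation3 "δ[" m "]" => (fun h : ℕ => if h = m then (1 : ℝ) else 0)

/-- `lconv` is linear in its first argument over finite sums. [this work] -/
theorem lconv_finsetSum_left {ι : Type*} (s : Finset ι) (M₁ M₂ : ℕ) (c : ι → ℝ) (f : ι → ℕ → ℝ) (ν : ℕ → ℝ) (h : ℕ) :
    lconv M₁ M₂ (fun i => ∑ m ∈ s, c m * f m i) ν h = ∑ m ∈ s, c m * lconv M₁ M₂ (f m) ν h := by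
  classical
  induction s using Finset.induction_on with
  | empty =>
    simp only [Finset.sum_empty]
    unfold lconv
    exact Finset.sum_eq_zero fun i _ => Finset.sum_eq_zero fun k _ => by split_ifs <;> simp
  | insert a s ha ih =>
    rw [Finset.sum_insert ha]
    have e : (fun i => ∑ m ∈ insert a s, c m * f m i) = fun i => c a * f a i + 1 * (∑ m ∈ s, c m * f m i) := by
      funext i; rw [Finset.sum_insert ha, one_mul]
    rw [e, lconv_lin_left, ih, one_mul]

/-- `lconv` is linear in its second argument over finite sums. [this work] -/
theorem lconv_finsetSum_right {ι : Type*} (s : Finset ι) (M₁ M₂ : ℕ) (c : ι → ℝ) (μ : ℕ → ℝ) (f : ι → ℕ → ℝ) (h : ℕ) :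
    lconv M₁ M₂ μ (fun k => ∑ m ∈ s, c m * f m k) h = ∑ m ∈ s, c m * lconv M₁ M₂ μ (f m) h := by
  classical
  induction s using Finset.induction_on with
  | empty =>
    simp only [Finset.sum_empty]
    unfold lconv
    exact Finset.sum_eq_zero fun i _ => Finset.sum_eq_zero fun k _ => by split_ifs <;> simp
  | insert a s ha ih =>
    rw [Finset.sum_insert ha]
    have e : (fun k => ∑ m ∈ insert a s, c m * f m k) = fun k => c a * f a k + 1 * (∑ m ∈ s, c m * f m k) := by
      funext k; rw [Finset.sum_insert ha, one_mul]
    rw [e, lconv_lin_right, ih, one_mul]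

/-- **a law is the mixture of its atoms, through the gate**: for `ρ` on `{0..M}` of mass `1`,
`gate ρ q = Σ_{m ≤ M} ρ m · gate δ[m] q`. [this work] -/
theorem gate_atomic (M : ℕ) (ρ : ℕ → ℝ) (q : ℝ) (hM : ∀ h, M < h → ρ h = 0) (h1 : ∑ m ∈ Finset.range (M + 1), ρ m = 1) (h : ℕ) :
    gate ρ q h = ∑ m ∈ Finset.range (M + 1), ρ m * gate δ[m] q h := by
  have e : ∀ m, ρ m * gate δ[m] q h = q * (ρ m * (if h = m then (1 : ℝ) else 0)) + (ρ m) * ((1 - q) * (if h = 0 then (1 : ℝ) else 0)) := by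
    intro m; simp only [gate_apply]; ring
  simp_rw [e]
  rw [Finset.sum_add_distrib, ← Finset.mul_sum, ← Finset.sum_mul, h1, one_mul, gate_apply]
  congr 1
  by_cases hh : h ≤ M
  · rw [Finset.sum_eq_single h]
    · simp
    · intro m _ hm; rw [if_neg (Ne.symm hm), mul_zero]
    · intro hn; exact absurd (Finset.mem_range.2 (Nat.lt_succ_of_le hh)) hn
  · rw [hM h (not_le.1 hh), mul_zero]
    symm
    refine mul_eq_zero_of_right q (Finset.sum_eq_zero fun m hm => ?_)
    rw [Finset.mem_range] at hm
    rw [if_neg (by omega), mul_zero]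

/-- **the gate of a mixture is the mixture of the gates** (weights summing to `1`). [this work] -/
theorem gate_sum_affine {ι : Type*} (s : Finset ι) (c : ι → ℝ) (X : ι → ℕ → ℝ) (a : ℝ) (hc : ∑ m ∈ s, c m = 1) (h : ℕ) :
    gate (fun k => ∑ m ∈ s, c m * X m k) a h = ∑ m ∈ s, c m * gate (X m) a h := by
  have e : ∀ m, c m * gate (X m) a h = a * (c m * X m h) + c m * ((1 - a) * (if h = 0 then (1 : ℝ) else 0)) := by
    intro m; rw [gate_apply]; ring
  simp_rw [e]
  rw [Finset.sum_add_distrib, ← Finset.mul_sum, ← Finset.sum_mul, hc, one_mul, gate_apply]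

/-- **RE-GATING A MIXTURE TO A COMMON TARGET** (the phantom-δ₀ bookkeeping): if `Σ c = 1`, `Σ w = 1` and `w m · g m = a · c m` for
every `m`, then `Σ_m c m · gate_a(X m) = Σ_m w m · gate_{g m}(X m)` pointwise. [this work] -/
theorem regate_mixture {ι : Type*} (s : Finset ι) (c w g : ι → ℝ) (X : ι → ℕ → ℝ) (a : ℝ) (hc : ∑ m ∈ s, c m = 1)
    (hw : ∑ m ∈ s, w m = 1) (hwg : ∀ m ∈ s, w m * g m = a * c m) (h : ℕ) :
    ∑ m ∈ s, c m * gate (X m) a h = ∑ m ∈ s, w m * gate (X m) (g m) h := by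
  have e1 : ∀ m ∈ s, c m * gate (X m) a h = (a * c m) * X m h + c m * ((1 - a) * (if h = 0 then (1 : ℝ) else 0)) := by
    intro m _; rw [gate_apply]; ring
  have e2 : ∀ m ∈ s, w m * gate (X m) (g m) h
      = (a * c m) * X m h + (w m - a * c m) * (if h = 0 then (1 : ℝ) else 0) := by
    intro m hm; rw [gate_apply, ← hwg m hm]; ring
  rw [Finset.sum_congr rfl e1, Finset.sum_congr rfl e2, Finset.sum_add_distrib, Finset.sum_add_distrib, ← Finset.sum_mul,
    ← Finset.sum_mul, Finset.sum_sub_distrib, ← Finset.mul_sum, hc, hw]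
  ring

/-- **THE ATOMIC EXPANSION of the triple gated convolution**: with `ρᵢ` of mass `1` on `{0..Mᵢ}`,
`gate_{q₁}ρ₁ ∗ gate_{q₂}ρ₂ ∗ gate_{q₃}ρ₃ = Σ_{m₃} Σ_{m₁} Σ_{m₂} ρ₁m₁ ρ₂m₂ ρ₃m₃ · (gate_{q₁}δ_{m₁} ∗ gate_{q₂}δ_{m₂} ∗ gate_{q₃}δ_{m₃})`. [this work] -/
theorem lconv3_atomic (M₁ M₂ M₃ : ℕ) (ρ₁ ρ₂ ρ₃ : ℕ → ℝ) (q₁ q₂ q₃ : ℝ)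
    (h₁M : ∀ h, M₁ < h → ρ₁ h = 0) (h₂M : ∀ h, M₂ < h → ρ₂ h = 0) (h₃M : ∀ h, M₃ < h → ρ₃ h = 0)
    (h₁1 : ∑ m ∈ Finset.range (M₁ + 1), ρ₁ m = 1) (h₂1 : ∑ m ∈ Finset.range (M₂ + 1), ρ₂ m = 1)
    (h₃1 : ∑ m ∈ Finset.range (M₃ + 1), ρ₃ m = 1) (h : ℕ) :
    lconv (M₁ + M₂) M₃ (lconv M₁ M₂ (gate ρ₁ q₁) (gate ρ₂ q₂)) (gate ρ₃ q₃) h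
      = ∑ m₃ ∈ Finset.range (M₃ + 1), ∑ m₁ ∈ Finset.range (M₁ + 1), ∑ m₂ ∈ Finset.range (M₂ + 1),
          ρ₁ m₁ * ρ₂ m₂ * ρ₃ m₃ *
            lconv (M₁ + M₂) M₃ (lconv M₁ M₂ (gate δ[m₁] q₁) (gate δ[m₂] q₂)) (gate δ[m₃] q₃) h := by
  have e₃ : gate ρ₃ q₃ = fun k => ∑ m ∈ Finset.range (M₃ + 1), ρ₃ m * gate δ[m] q₃ k :=
    funext fun k => gate_atomic M₃ ρ₃ q₃ h₃M h₃1 k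
  have e₁ : gate ρ₁ q₁ = fun k => ∑ m ∈ Finset.range (M₁ + 1), ρ₁ m * gate δ[m] q₁ k :=
    funext fun k => gate_atomic M₁ ρ₁ q₁ h₁M h₁1 k
  have e₂ : gate ρ₂ q₂ = fun k => ∑ m ∈ Finset.range (M₂ + 1), ρ₂ m * gate δ[m] q₂ k :=
    funext fun k => gate_atomic M₂ ρ₂ q₂ h₂M h₂1 k
  have inner : lconv M₁ M₂ (gate ρ₁ q₁) (gate ρ₂ q₂)
      = fun k => ∑ m₁ ∈ Finset.range (M₁ + 1), ρ₁ m₁ *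
          (∑ m₂ ∈ Finset.range (M₂ + 1), ρ₂ m₂ * lconv M₁ M₂ (gate δ[m₁] q₁) (gate δ[m₂] q₂) k) := by
    funext k
    rw [e₁, lconv_finsetSum_left]
    refine Finset.sum_congr rfl fun m₁ _ => ?_
    rw [e₂, lconv_finsetSum_right]
  rw [e₃, lconv_finsetSum_right]
  refine Finset.sum_congr rfl fun m₃ _ => ?_
  rw [inner, lconv_finsetSum_left, Finset.mul_sum]
  refine Finset.sum_congr rfl fun m₁ _ => ?_
  have e : (fun k => ∑ m₂ ∈ Finset.range (M₂ + 1), ρ₂ m₂ * lconv M₁ M₂ (gate δ[m₁] q₁) (gate δ[m₂] q₂) k)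
      = fun k => ∑ m₂ ∈ Finset.range (M₂ + 1), ρ₂ m₂ * lconv M₁ M₂ (gate δ[m₁] q₁) (gate δ[m₂] q₂) k := rfl
  rw [lconv_finsetSum_left, Finset.mul_sum, Finset.mul_sum]
  refine Finset.sum_congr rfl fun m₂ _ => ?_
  ring


/-- the atomic expansion over ONE product index set. [this work] -/
theorem lconv3_atomic_prod (M₁ M₂ M₃ : ℕ) (ρ₁ ρ₂ ρ₃ : ℕ → ℝ) (q₁ q₂ q₃ : ℝ)
    (h₁M : ∀ h, M₁ < h → ρ₁ h = 0) (h₂M : ∀ h, M₂ < h → ρ₂ h = 0) (h₃M : ∀ h, M₃ < h → ρ₃ h = 0)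
    (h₁1 : ∑ m ∈ Finset.range (M₁ + 1), ρ₁ m = 1) (h₂1 : ∑ m ∈ Finset.range (M₂ + 1), ρ₂ m = 1)
    (h₃1 : ∑ m ∈ Finset.range (M₃ + 1), ρ₃ m = 1) (h : ℕ) :
    lconv (M₁ + M₂) M₃ (lconv M₁ M₂ (gate ρ₁ q₁) (gate ρ₂ q₂)) (gate ρ₃ q₃) h
      = ∑ m ∈ Finset.range (M₃ + 1) ×ˢ (Finset.range (M₁ + 1) ×ˢ Finset.range (M₂ + 1)),
          ρ₁ m.2.1 * ρ₂ m.2.2 * ρ₃ m.1 *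
            lconv (M₁ + M₂) M₃ (lconv M₁ M₂ (gate δ[m.2.1] q₁) (gate δ[m.2.2] q₂)) (gate δ[m.1] q₃) h := by
  rw [lconv3_atomic M₁ M₂ M₃ ρ₁ ρ₂ ρ₃ q₁ q₂ q₃ h₁M h₂M h₃M h₁1 h₂1 h₃1 h, Finset.sum_product]
  refine Finset.sum_congr rfl fun m₃ _ => ?_
  rw [Finset.sum_product]

/-- the product weights have mass `1`. [this work] -/
theorem atomic_weights_sum (M₁ M₂ M₃ : ℕ) (ρ₁ ρ₂ ρ₃ : ℕ → ℝ)
    (h₁1 : ∑ m ∈ Finset.range (M₁ + 1), ρ₁ m = 1) (h₂1 : ∑ m ∈ Finset.range (M₂ + 1), ρ₂ m = 1)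
    (h₃1 : ∑ m ∈ Finset.range (M₃ + 1), ρ₃ m = 1) :
    ∑ m ∈ Finset.range (M₃ + 1) ×ˢ (Finset.range (M₁ + 1) ×ˢ Finset.range (M₂ + 1)), ρ₁ m.2.1 * ρ₂ m.2.2 * ρ₃ m.1 = 1 := by
  rw [Finset.sum_product]
  have e : ∀ m₃ ∈ Finset.range (M₃ + 1),
      ∑ y ∈ Finset.range (M₁ + 1) ×ˢ Finset.range (M₂ + 1), ρ₁ y.1 * ρ₂ y.2 * ρ₃ m₃ = ρ₃ m₃ := by
    intro m₃ _
    rw [Finset.sum_product]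
    have e2 : ∀ m₁ ∈ Finset.range (M₁ + 1), ∑ m₂ ∈ Finset.range (M₂ + 1), ρ₁ m₁ * ρ₂ m₂ * ρ₃ m₃ = ρ₁ m₁ * ρ₃ m₃ := by
      intro m₁ _
      have : ∑ m₂ ∈ Finset.range (M₂ + 1), ρ₁ m₁ * ρ₂ m₂ * ρ₃ m₃ = (ρ₁ m₁ * ρ₃ m₃) * ∑ m₂ ∈ Finset.range (M₂ + 1), ρ₂ m₂ := by
        rw [Finset.mul_sum]; refine Finset.sum_congr rfl fun m₂ _ => ?_; ring
      rw [this, h₂1, mul_one]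
    rw [Finset.sum_congr rfl e2, ← Finset.sum_mul, h₁1, one_mul]
  rw [Finset.sum_congr rfl e, h₃1]

/-- the product weights have first moment `q₁R₁ + q₂R₂ + q₃R₃` against `q₁m₁ + q₂m₂ + q₃m₃`. [this work] -/
theorem atomic_weights_mean (M₁ M₂ M₃ : ℕ) (ρ₁ ρ₂ ρ₃ : ℕ → ℝ) (q₁ q₂ q₃ : ℝ)
    (h₁1 : ∑ m ∈ Finset.range (M₁ + 1), ρ₁ m = 1) (h₂1 : ∑ m ∈ Finset.range (M₂ + 1), ρ₂ m = 1)
    (h₃1 : ∑ m ∈ Finset.range (M₃ + 1), ρ₃ m = 1) :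
    ∑ m ∈ Finset.range (M₃ + 1) ×ˢ (Finset.range (M₁ + 1) ×ˢ Finset.range (M₂ + 1)),
        ρ₁ m.2.1 * ρ₂ m.2.2 * ρ₃ m.1 * (q₁ * (m.2.1 : ℝ) + q₂ * (m.2.2 : ℝ) + q₃ * (m.1 : ℝ))
      = q₁ * ∑ m ∈ Finset.range (M₁ + 1), (m : ℝ) * ρ₁ m + q₂ * ∑ m ∈ Finset.range (M₂ + 1), (m : ℝ) * ρ₂ m
        + q₃ * ∑ m ∈ Finset.range (M₃ + 1), (m : ℝ) * ρ₃ m := by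
  -- split into the three moments
  have split : ∀ m : ℕ × (ℕ × ℕ), ρ₁ m.2.1 * ρ₂ m.2.2 * ρ₃ m.1 * (q₁ * (m.2.1 : ℝ) + q₂ * (m.2.2 : ℝ) + q₃ * (m.1 : ℝ))
      = q₁ * (((m.2.1 : ℝ) * ρ₁ m.2.1) * ρ₂ m.2.2 * ρ₃ m.1) + q₂ * (ρ₁ m.2.1 * ((m.2.2 : ℝ) * ρ₂ m.2.2) * ρ₃ m.1)
        + q₃ * (ρ₁ m.2.1 * ρ₂ m.2.2 * ((m.1 : ℝ) * ρ₃ m.1)) := fun m => by ring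
  simp_rw [split]
  rw [Finset.sum_add_distrib, Finset.sum_add_distrib, ← Finset.mul_sum, ← Finset.mul_sum, ← Finset.mul_sum]
  -- a generic product-sum factorisation
  have fact : ∀ (f₁ f₂ f₃ : ℕ → ℝ),
      ∑ m ∈ Finset.range (M₃ + 1) ×ˢ (Finset.range (M₁ + 1) ×ˢ Finset.range (M₂ + 1)), f₁ m.2.1 * f₂ m.2.2 * f₃ m.1
        = (∑ m ∈ Finset.range (M₁ + 1), f₁ m) * (∑ m ∈ Finset.range (M₂ + 1), f₂ m) * (∑ m ∈ Finset.range (M₃ + 1), f₃ m) := by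
    intro f₁ f₂ f₃
    have pair : ∑ p ∈ Finset.range (M₁ + 1) ×ˢ Finset.range (M₂ + 1), f₁ p.1 * f₂ p.2
        = (∑ m ∈ Finset.range (M₁ + 1), f₁ m) * (∑ m ∈ Finset.range (M₂ + 1), f₂ m) := by
      rw [Finset.sum_product, Finset.sum_mul_sum]
    calc ∑ m ∈ Finset.range (M₃ + 1) ×ˢ (Finset.range (M₁ + 1) ×ˢ Finset.range (M₂ + 1)), f₁ m.2.1 * f₂ m.2.2 * f₃ m.1
        = ∑ c ∈ Finset.range (M₃ + 1), ∑ p ∈ Finset.range (M₁ + 1) ×ˢ Finset.range (M₂ + 1), f₁ p.1 * f₂ p.2 * f₃ c := by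
          rw [Finset.sum_product]
      _ = ∑ c ∈ Finset.range (M₃ + 1), (∑ p ∈ Finset.range (M₁ + 1) ×ˢ Finset.range (M₂ + 1), f₁ p.1 * f₂ p.2) * f₃ c := by
          refine Finset.sum_congr rfl fun c _ => ?_
          rw [Finset.sum_mul]
      _ = (∑ p ∈ Finset.range (M₁ + 1) ×ˢ Finset.range (M₂ + 1), f₁ p.1 * f₂ p.2) * ∑ c ∈ Finset.range (M₃ + 1), f₃ c := by
          rw [Finset.mul_sum]
      _ = _ := by rw [pair]
  rw [fact (fun m => (m : ℝ) * ρ₁ m) ρ₂ ρ₃, fact ρ₁ (fun m => (m : ℝ) * ρ₂ m) ρ₃, fact ρ₁ ρ₂ (fun m => (m : ℝ) * ρ₃ m),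
    h₁1, h₂1, h₃1]
  ring

/-- **THE ATOMIC RE-GATING IDENTITY (three gated trees).**  With `ρᵢ` probability laws on `{0..Mᵢ}`, `ρ₁` without an atom at `0` (a relay at
its root), root gates `qᵢ > 0`, an outer gate `a`, and `S = a(q₁R₁ + q₂R₂ + q₃R₃)` (`Rᵢ` the means), `S ≠ 0`:
`gate_a(∏ gate_{qᵢ}ρᵢ) = Σ_m w_m · gate_{g_m}(gate_{q₁}δ_{m₁} ∗ gate_{q₂}δ_{m₂} ∗ gate_{q₃}δ_{m₃})`, `g_m = S/(Σqᵢmᵢ)`, `w_m = a·ρ₁m₁ρ₂m₂ρ₃m₃·(Σqᵢmᵢ)/S`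
(on the index `m = (m₃,(m₁,m₂))`; uncharged indices carry weight `0`).  Every component is a gated BLOB sibling group of mean `S`. [this work] -/
theorem threeRoot_atomic_regate (M₁ M₂ M₃ : ℕ) (ρ₁ ρ₂ ρ₃ : ℕ → ℝ) (q₁ q₂ q₃ a R₁ R₂ R₃ : ℝ)
    (h₁M : ∀ h, M₁ < h → ρ₁ h = 0) (h₂M : ∀ h, M₂ < h → ρ₂ h = 0) (h₃M : ∀ h, M₃ < h → ρ₃ h = 0)
    (h₁1 : ∑ m ∈ Finset.range (M₁ + 1), ρ₁ m = 1) (h₂1 : ∑ m ∈ Finset.range (M₂ + 1), ρ₂ m = 1)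
    (h₃1 : ∑ m ∈ Finset.range (M₃ + 1), ρ₃ m = 1)
    (hR₁ : ∑ h ∈ Finset.range (M₁ + 1), (h : ℝ) * ρ₁ h = R₁) (hR₂ : ∑ h ∈ Finset.range (M₂ + 1), (h : ℝ) * ρ₂ h = R₂)
    (hR₃ : ∑ h ∈ Finset.range (M₃ + 1), (h : ℝ) * ρ₃ h = R₃)
    (h₁0 : ρ₁ 0 = 0) (hq₁ : 0 < q₁) (hq₂ : 0 < q₂) (hq₃ : 0 < q₃)
    (hS : a * (q₁ * R₁ + q₂ * R₂ + q₃ * R₃) ≠ 0) (h : ℕ) :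
    gate (lconv (M₁ + M₂) M₃ (lconv M₁ M₂ (gate ρ₁ q₁) (gate ρ₂ q₂)) (gate ρ₃ q₃)) a h
      = ∑ m ∈ Finset.range (M₃ + 1) ×ˢ (Finset.range (M₁ + 1) ×ˢ Finset.range (M₂ + 1)),
          (a * (ρ₁ m.2.1 * ρ₂ m.2.2 * ρ₃ m.1) * (q₁ * (m.2.1 : ℝ) + q₂ * (m.2.2 : ℝ) + q₃ * (m.1 : ℝ))
              / (a * (q₁ * R₁ + q₂ * R₂ + q₃ * R₃)))
            * gate (lconv (M₁ + M₂) M₃ (lconv M₁ M₂ (gate δ[m.2.1] q₁) (gate δ[m.2.2] q₂)) (gate δ[m.1] q₃))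
                ((a * (q₁ * R₁ + q₂ * R₂ + q₃ * R₃)) / (q₁ * (m.2.1 : ℝ) + q₂ * (m.2.2 : ℝ) + q₃ * (m.1 : ℝ))) h := by
  set s := Finset.range (M₃ + 1) ×ˢ (Finset.range (M₁ + 1) ×ˢ Finset.range (M₂ + 1)) with hsdef
  set S := a * (q₁ * R₁ + q₂ * R₂ + q₃ * R₃) with hSdef
  have eT : lconv (M₁ + M₂) M₃ (lconv M₁ M₂ (gate ρ₁ q₁) (gate ρ₂ q₂)) (gate ρ₃ q₃)
      = fun k => ∑ m ∈ s, (ρ₁ m.2.1 * ρ₂ m.2.2 * ρ₃ m.1) *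
          lconv (M₁ + M₂) M₃ (lconv M₁ M₂ (gate δ[m.2.1] q₁) (gate δ[m.2.2] q₂)) (gate δ[m.1] q₃) k :=
    funext fun k => lconv3_atomic_prod M₁ M₂ M₃ ρ₁ ρ₂ ρ₃ q₁ q₂ q₃ h₁M h₂M h₃M h₁1 h₂1 h₃1 k
  have hc : ∑ m ∈ s, ρ₁ m.2.1 * ρ₂ m.2.2 * ρ₃ m.1 = 1 := atomic_weights_sum M₁ M₂ M₃ ρ₁ ρ₂ ρ₃ h₁1 h₂1 h₃1
  rw [eT, gate_sum_affine s _ _ a hc h]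
  refine regate_mixture s _ _ _ _ a hc ?_ ?_ h
  · -- the new weights have mass 1
    have e : ∀ m ∈ s, a * (ρ₁ m.2.1 * ρ₂ m.2.2 * ρ₃ m.1) * (q₁ * (m.2.1 : ℝ) + q₂ * (m.2.2 : ℝ) + q₃ * (m.1 : ℝ)) / S
        = (a / S) * (ρ₁ m.2.1 * ρ₂ m.2.2 * ρ₃ m.1 * (q₁ * (m.2.1 : ℝ) + q₂ * (m.2.2 : ℝ) + q₃ * (m.1 : ℝ))) := by
      intro m _; field_simp
    rw [Finset.sum_congr rfl e, ← Finset.mul_sum, atomic_weights_mean M₁ M₂ M₃ ρ₁ ρ₂ ρ₃ q₁ q₂ q₃ h₁1 h₂1 h₃1, hR₁, hR₂, hR₃,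
      div_mul_eq_mul_div, div_eq_one_iff_eq hS, hSdef]
  · -- `w·g = a·c`: charged indices by algebra, uncharged ones are `0 = 0`
    intro m hm
    by_cases hz : q₁ * (m.2.1 : ℝ) + q₂ * (m.2.2 : ℝ) + q₃ * (m.1 : ℝ) = 0
    · -- then all three atoms are `0`, and the weight vanishes by `ρᵢ 0 = 0`
      have h1 : (m.2.1 : ℝ) = 0 := by
        have t1 : 0 ≤ q₁ * (m.2.1 : ℝ) := mul_nonneg hq₁.le (Nat.cast_nonneg _)
        have t2 : 0 ≤ q₂ * (m.2.2 : ℝ) := mul_nonneg hq₂.le (Nat.cast_nonneg _)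
        have t3 : 0 ≤ q₃ * (m.1 : ℝ) := mul_nonneg hq₃.le (Nat.cast_nonneg _)
        have : q₁ * (m.2.1 : ℝ) = 0 := by linarith
        rcases mul_eq_zero.1 this with hq | hm1
        · exact absurd hq hq₁.ne'
        · exact hm1
      have hm0 : m.2.1 = 0 := by exact_mod_cast h1
      rw [hz, hm0, h₁0]; simp
    · field_simp

end LawDec

end Quant

end Summit.CriticalPhenomena.PercolationContinuityZ3.Theorems
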